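import Summits.ValiantsHypothesis.ValiantsHypothesis.Theorems.KPlusLogSqLawStaticPathOneChain
import Summits.ValiantsHypothesis.ValiantsHypothesis.Theorems.KPlusLogSqLawStaticPathSilentFlipsSweep

/-!
# Route «KPlusLogSqLaw» — parametric max-weight independent set on a path: UNCOVERED POSITIONS FROM THE LEFT FOLD ALONE

HONEST FRAMING.  Helper toward the crux `WeakLifting` (item `stmt-ValiantsHypothesis-19561`, route `KPlusLogSqLaw`, cell `pub-symmetroid`,
seat val-sym-lift-p4 g24, 2026-08-29) on the line of its witness-plan stub `stub_tridiagonalSectorB` (tropical twin of the STATIC tridiagonal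
sector = parametric maximum-weight independent set on a path; located theory `HOME/val-sym-lift-p4/DELETION.md` §1.3).  Fold instantiation of
`…StaticPathOneChain.rightRec_iff_parity_of_leftRec` through the greedy semantics of the two folds (`leftRecord_sem` / `rightRecord_sem`,
`…StaticPathSilentFlipsSweep`) and the two-sided record characterisation `avoid_iff_folds_of_unique` (`…StaticPathRecords`):
**`uncovered_iff_leftTouch_parity`** — for the block `i+1, …, i+n` with pairwise distinct prefix-sum values at `θ` and unique optimum `M`, a
position `u ≤ n` with no touch point of the LEFT alternating fold strictly between `u` and `q`, where `q` is the next touch point (`q ≤ n`) or the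
sentinel `n + 1`, is UNCOVERED by `M` iff `u` is a left touch point and `u + q` is odd.  So the optimal independent set is read off the LEFT fold
alone (the right fold is redundant): the uncovered positions are the left touch points whose next left touch point has the opposite parity —
the «chain form» of DELETION §1.3 in the kernel.  Statements about a path DP; nothing here asserts anything about `WeakLifting`, `TropicalB`,
`KPlusLogSqLaw`, the stub in its window, `MatrixDescartes` (stmt-ValiantsHypothesis-18050) or `VP ≠ VNP`; the ORDER QUESTION stays open.
-/

set_option linter.dupNamespace false
set_option autoImplicit false

namespace Summit.ValiantsHypothesis.ValiantsHypothesis.Theorems.KPlusLogSqLaw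

open Finset Classical

namespace StaticPathFold

noncomputable section

section OneChainFold

variable (w₁ w₀ : ℕ → ℝ)

/-- **UNCOVERED POSITIONS FROM THE LEFT FOLD ALONE** (DELETION §1.3 chain form): with pairwise distinct prefix-sum values and unique optimum `M`, a
position `u ≤ n` whose next left touch point is `q` (no left touch point strictly between; `q = n + 1` if none) is uncovered iff `u` is a left
touch point and `u + q` is odd. [folklore] -/
theorem uncovered_iff_leftTouch_parity {i n : ℕ} {θ : ℝ} {M : Finset ℕ} (hM : M ∈ indepSets i n)
    (huniq : ∀ S ∈ indepSets i n, S ≠ M → ∑ t ∈ S, W w₁ w₀ t θ < ∑ t ∈ M, W w₁ w₀ t θ)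
    (hdis : ∀ p q, p ≤ n → q ≤ n → p ≠ q → L (altA (shift i w₁)) (altB (shift i w₀)) p θ ≠ L (altA (shift i w₁)) (altB (shift i w₀)) q θ)
    {u q : ℕ} (hu : u ≤ n) (huq : u < q) (hqn : q ≤ n + 1)
    (hno : ∀ w, u < w → w < q → ¬ fold (altA (shift i w₁)) (altB (shift i w₀)) w θ = L (altA (shift i w₁)) (altB (shift i w₀)) w θ)
    (hq : q = n + 1 ∨ (q ≤ n ∧ fold (altA (shift i w₁)) (altB (shift i w₀)) q θ = L (altA (shift i w₁)) (altB (shift i w₀)) q θ)) :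
    (i + u ∉ M ∧ i + u + 1 ∉ M) ↔
      (fold (altA (shift i w₁)) (altB (shift i w₀)) u θ = L (altA (shift i w₁)) (altB (shift i w₀)) u θ ∧ ¬ (Even u ↔ Even q)) := by
  set A := altA (shift i w₁) with hA
  set B := altB (shift i w₀) with hB
  set A' := altA (shift 0 (rev i n w₁)) with hA'
  set B' := altB (shift 0 (rev i n w₀)) with hB'
  rw [avoid_iff_folds_of_unique w₁ w₀ hM huniq hu]
  refine and_congr_right (fun hL => ?_)
  have hRn : fold A' B' (n - n) θ = L A' B' (n - n) θ := by rw [Nat.sub_self]; exact fold_zero A' B' θ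
  have h := rightRec_iff_parity_of_leftRec (fun v => L A B v θ) 0 n (Lr := fun v => fold A B v θ = L A B v θ)
    (Rr := fun v => fold A' B' (n - v) θ = L A' B' (n - v) θ) hRn (leftRecord_sem A B hdis) (rightRecord_sem w₁ w₀ hdis) hdis
    hu huq hqn hL hno hq
  simpa only [Nat.add_zero] using h

end OneChainFold

end

end StaticPathFold

end Summit.ValiantsHypothesis.ValiantsHypothesis.Theorems.KPlusLogSqLaw
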